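import Summits.HodgeConjecture.HodgeConjecture.Cruxes.BlochSeedDiscOne.BoxIdentity

/-!
# CoverDemand — the COVER-DEMAND LAW of the shadow F-layer, kernel form (anomaly g16; memo `SHELL3-FLAYER-anomaly-g16.md` §5b)

A LEAF module on top of negation g21's `BoxIdentity` (v2, tree f393eca32773): every statement below is a few lines of
arithmetic on `box_identity`, `lattice_sixteen`, `Psi_dvd_sixteen` (credit: negation g21; the lattice was this seat's
(S3-5) candidate, proved there).  Nothing here is specific to a ring, a room or a height beyond `OnAlphabet`.

CONTENT (every height `hgt`, every design on the alphabet satisfying clause 1 `A1e`):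
* `Psi_class_const` — the box mass `Ψ_x` depends only on the phase class `wt x`;
* `Psi_two_sub_zero`, `Psi_one_sub_three` — `Ψ(class 2) − Ψ(class 0) = Re μ`, `Ψ(class 1) − Ψ(class 3) = Im μ`;
* `taxicab_ge_32` — `μ ≠ 0 → 32 ≤ |Re μ| + |Im μ|` (the 16(1+i)ℤ[i] lattice has no point of taxicab norm 16);
* `cover_demand` — `μ ≠ 0 → 32 ≤ |Ψ₀| + |Ψ₁| + |Ψ₂| + |Ψ₃|` over the four classes: the total COVER MULTIPLICITY is ≥ 2
  (in units of 16), hence `two_covers`: two distinct classes carry `|Ψ| ≥ 16`, or one class carries `|Ψ| ≥ 32` —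
  a charged design never gets away with a single simple class cover;
* `Ncover_of_Psi_pos` ∕ `Pcover_of_Psi_neg` — a class with `Ψ > 0` (resp. `< 0`) is an N-cover (resp. P-cover) of
  multiplicity `Ψ∕16 ≥ 1`: `Ψ + Σ_P m ψ_x ≤ Σ_N m ψ_x` on every box of the class, and the box meets the N (resp. P) support;
* `sigma_zero_lattice` — `σ = 0 → 32 ∣ Re μ ∧ 32 ∣ Im μ`; `charge_sigma_hull` — `μ ≠ 0 → 32 ≤ max |Re μ| |Im μ| + 2|σ|`
  (the symmetric form of the LP cut (K2) of `SHELL3-LPCUTS-anomaly-g16.md`: the minimal charge |μ|∞ = 16 forces |σ| ≥ 8).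

READING (not formalised here): with the fine room's per-cell box counts (an H-free N cell meets ≤ 7 boxes of a class, a P cell
≤ 10) each simple cover costs ≥ 10 (N) ∕ ≥ 7 (P) DISTINCT charged cells — memo §4–§5b; that count is room-specific and is left
to the room's owner module.  Letter designs are not sheaves: nothing in this file bears on HC ∕ HC_AV ∕ `BlochSeedDiscOne`.
-/

set_option linter.dupNamespace false
set_option autoImplicit false

namespace Summit.HodgeConjecture.HodgeConjecture.Cruxes.BlochSeedDiscOne.CoverDemand

open Summit.HodgeConjecture.HodgeConjecture.Cruxes.BlochSeedDiscOne.DepthBoundA4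
open Summit.HodgeConjecture.HodgeConjecture.Cruxes.BlochSeedDiscOne.BoxIdentity

/-! ## §1 Box masses are class functions; the two class differences are the charge -/

/-- `Ψ_x` depends only on the phase class `wt x`. -/
theorem Psi_class_const (hgt : ℤ) (D : Design) (hA : A1e D) (x y : Fin 4 → Fin 4) (h : wt x = wt y) :
    Psi hgt x D = Psi hgt y D := by
  have hx := box_identity hgt D hA x
  have hy := box_identity hgt D hA y
  rw [h] at hx
  omega

/-- `Ψ(class 2) − Ψ(class 0) = Re μ`. -/
theorem Psi_two_sub_zero (hgt : ℤ) (D : Design) (hA : A1e D) (x2 x0 : Fin 4 → Fin 4) (h2 : wt x2 = 2) (h0 : wt x0 = 0) :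
    Psi hgt x2 D - Psi hgt x0 D = D.mu.re := by
  have b2 := box_identity hgt D hA x2
  have b0 := box_identity hgt D hA x0
  obtain ⟨r0, -, r2, -⟩ := ipow_mu_re D
  rw [h2, r2] at b2
  rw [h0, r0] at b0
  omega

/-- `Ψ(class 1) − Ψ(class 3) = Im μ`. -/
theorem Psi_one_sub_three (hgt : ℤ) (D : Design) (hA : A1e D) (x1 x3 : Fin 4 → Fin 4) (h1 : wt x1 = 1) (h3 : wt x3 = 3) :
    Psi hgt x1 D - Psi hgt x3 D = D.mu.im := by
  have b1 := box_identity hgt D hA x1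
  have b3 := box_identity hgt D hA x3
  obtain ⟨-, r1, -, r3⟩ := ipow_mu_re D
  rw [h1, r1] at b1
  rw [h3, r3] at b3
  omega

/-! ## §2 The lattice has no point of taxicab norm 16 -/

theorem re_ne_or_im_ne (D : Design) (hμ : D.mu ≠ 0) : D.mu.re ≠ 0 ∨ D.mu.im ≠ 0 := by
  by_cases hre : D.mu.re = 0
  · exact Or.inr (fun him => hμ (Zsqrtd.ext hre him))
  · exact Or.inl hre

/-- `μ ≠ 0 → |Re μ| + |Im μ| ≥ 32`. -/
theorem taxicab_ge_32 (hgt : ℤ) (D : Design) (hO : D.OnAlphabet hgt) (hA : A1e D) (hμ : D.mu ≠ 0) :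
    32 ≤ |D.mu.re| + |D.mu.im| := by
  obtain ⟨l0, l1, l2, -⟩ := lattice_sixteen hgt D hO hA
  have hne := re_ne_or_im_ne D hμ
  rcases le_or_gt 0 D.mu.re with hr | hr <;> rcases le_or_gt 0 D.mu.im with hi | hi
  · rw [abs_of_nonneg hr, abs_of_nonneg hi]; omega
  · rw [abs_of_nonneg hr, abs_of_neg hi]; omega
  · rw [abs_of_neg hr, abs_of_nonneg hi]; omega
  · rw [abs_of_neg hr, abs_of_neg hi]; omega

/-- `max(|Re μ|, |Im μ|) ≥ 16` as a disjunction (cf. `exists_good_class`). -/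
theorem sup_ge_16 (hgt : ℤ) (D : Design) (hO : D.OnAlphabet hgt) (hA : A1e D) (hμ : D.mu ≠ 0) :
    16 ≤ |D.mu.re| ∨ 16 ≤ |D.mu.im| := by
  obtain ⟨l0, l1, -, -⟩ := lattice_sixteen hgt D hO hA
  rcases re_ne_or_im_ne D hμ with h | h
  · left
    rcases le_or_gt 0 D.mu.re with hr | hr
    · rw [abs_of_nonneg hr]; omega
    · rw [abs_of_neg hr]; omega
  · right
    rcases le_or_gt 0 D.mu.im with hi | hi
    · rw [abs_of_nonneg hi]; omega
    · rw [abs_of_neg hi]; omega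

/-! ## §3 The cover-demand law -/

/-- **COVER-DEMAND LAW.** Over one box of each phase class, `|Ψ₀| + |Ψ₁| + |Ψ₂| + |Ψ₃| ≥ 32`: the total cover multiplicity
of a charged design is at least 2 (in units of 16). -/
theorem cover_demand (hgt : ℤ) (D : Design) (hO : D.OnAlphabet hgt) (hA : A1e D) (hμ : D.mu ≠ 0)
    (x0 x1 x2 x3 : Fin 4 → Fin 4) (h0 : wt x0 = 0) (h1 : wt x1 = 1) (h2 : wt x2 = 2) (h3 : wt x3 = 3) :
    32 ≤ |Psi hgt x0 D| + |Psi hgt x1 D| + |Psi hgt x2 D| + |Psi hgt x3 D| := by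
  have e20 := Psi_two_sub_zero hgt D hA x2 x0 h2 h0
  have e13 := Psi_one_sub_three hgt D hA x1 x3 h1 h3
  have t := taxicab_ge_32 hgt D hO hA hμ
  have a20 : |D.mu.re| ≤ |Psi hgt x2 D| + |Psi hgt x0 D| := by rw [← e20]; exact abs_sub _ _
  have a13 : |D.mu.im| ≤ |Psi hgt x1 D| + |Psi hgt x3 D| := by rw [← e13]; exact abs_sub _ _
  omega

/-- `|Ψ_x|` is a multiple of 16, so `0 < |Ψ_x| → 16 ≤ |Ψ_x|` and `16 < |Ψ_x| → 32 ≤ |Ψ_x|`. -/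
theorem abs_Psi_steps (hgt : ℤ) (D : Design) (hO : D.OnAlphabet hgt) (x : Fin 4 → Fin 4) :
    (0 < |Psi hgt x D| → 16 ≤ |Psi hgt x D|) ∧ (16 < |Psi hgt x D| → 32 ≤ |Psi hgt x D|) := by
  have hd := Psi_dvd_sixteen hgt D hO x
  rcases le_or_gt 0 (Psi hgt x D) with h | h
  · rw [abs_of_nonneg h]; constructor <;> intro <;> omega
  · rw [abs_of_neg h]; constructor <;> intro <;> omega

/-- **TWO COVERS.** A charged design has two DISTINCT phase classes each with `|Ψ| ≥ 16`, or one class with `|Ψ| ≥ 32`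
(stated on the representative boxes `![k,0,0,0]`; transport to any box of the class with `Psi_class_const`). -/
theorem two_covers (hgt : ℤ) (D : Design) (hO : D.OnAlphabet hgt) (hA : A1e D) (hμ : D.mu ≠ 0) :
    (∃ i j : Fin 4, i ≠ j ∧ 16 ≤ |Psi hgt ![i, 0, 0, 0] D| ∧ 16 ≤ |Psi hgt ![j, 0, 0, 0] D|) ∨
      (∃ i : Fin 4, 32 ≤ |Psi hgt ![i, 0, 0, 0] D|) := by
  have cd := cover_demand hgt D hO hA hμ ![0, 0, 0, 0] ![1, 0, 0, 0] ![2, 0, 0, 0] ![3, 0, 0, 0]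
    (wt_single 0) (wt_single 1) (wt_single 2) (wt_single 3)
  have s0 := abs_Psi_steps hgt D hO ![0, 0, 0, 0]
  have s1 := abs_Psi_steps hgt D hO ![1, 0, 0, 0]
  have s2 := abs_Psi_steps hgt D hO ![2, 0, 0, 0]
  have s3 := abs_Psi_steps hgt D hO ![3, 0, 0, 0]
  by_cases g0 : 32 ≤ |Psi hgt ![0, 0, 0, 0] D|
  · exact Or.inr ⟨0, g0⟩
  by_cases g1 : 32 ≤ |Psi hgt ![1, 0, 0, 0] D|
  · exact Or.inr ⟨1, g1⟩
  by_cases g2 : 32 ≤ |Psi hgt ![2, 0, 0, 0] D|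
  · exact Or.inr ⟨2, g2⟩
  by_cases g3 : 32 ≤ |Psi hgt ![3, 0, 0, 0] D|
  · exact Or.inr ⟨3, g3⟩
  left
  -- now every |Ψ_k| ≤ 16, and they sum to ≥ 32: at least two equal 16
  have u0 : |Psi hgt ![0, 0, 0, 0] D| ≤ 16 := by by_contra h; exact g0 (s0.2 (by omega))
  have u1 : |Psi hgt ![1, 0, 0, 0] D| ≤ 16 := by by_contra h; exact g1 (s1.2 (by omega))
  have u2 : |Psi hgt ![2, 0, 0, 0] D| ≤ 16 := by by_contra h; exact g2 (s2.2 (by omega))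
  have u3 : |Psi hgt ![3, 0, 0, 0] D| ≤ 16 := by by_contra h; exact g3 (s3.2 (by omega))
  by_cases p0 : 16 ≤ |Psi hgt ![0, 0, 0, 0] D|
  · by_cases p1 : 16 ≤ |Psi hgt ![1, 0, 0, 0] D|
    · exact ⟨0, 1, by decide, p0, p1⟩
    by_cases p2 : 16 ≤ |Psi hgt ![2, 0, 0, 0] D|
    · exact ⟨0, 2, by decide, p0, p2⟩
    have p3 : 16 ≤ |Psi hgt ![3, 0, 0, 0] D| := by
      by_contra h
      have z1 : |Psi hgt ![1, 0, 0, 0] D| = 0 := by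
        by_contra hz; exact p1 (s1.1 (by have := abs_nonneg (Psi hgt ![1, 0, 0, 0] D); omega))
      have z2 : |Psi hgt ![2, 0, 0, 0] D| = 0 := by
        by_contra hz; exact p2 (s2.1 (by have := abs_nonneg (Psi hgt ![2, 0, 0, 0] D); omega))
      have z3 : |Psi hgt ![3, 0, 0, 0] D| = 0 := by
        by_contra hz; exact h (s3.1 (by have := abs_nonneg (Psi hgt ![3, 0, 0, 0] D); omega))
      omega
    exact ⟨0, 3, by decide, p0, p3⟩
  · -- |Ψ₀| < 16 ⇒ |Ψ₀| = 0; the other three sum to ≥ 32 with each ≤ 16 ⇒ two of them are 16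
    have z0 : |Psi hgt ![0, 0, 0, 0] D| = 0 := by
      by_contra hz; exact p0 (s0.1 (by have := abs_nonneg (Psi hgt ![0, 0, 0, 0] D); omega))
    by_cases p1 : 16 ≤ |Psi hgt ![1, 0, 0, 0] D|
    · by_cases p2 : 16 ≤ |Psi hgt ![2, 0, 0, 0] D|
      · exact ⟨1, 2, by decide, p1, p2⟩
      have z2 : |Psi hgt ![2, 0, 0, 0] D| = 0 := by
        by_contra hz; exact p2 (s2.1 (by have := abs_nonneg (Psi hgt ![2, 0, 0, 0] D); omega))
      have p3 : 16 ≤ |Psi hgt ![3, 0, 0, 0] D| := by omega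
      exact ⟨1, 3, by decide, p1, p3⟩
    · have z1 : |Psi hgt ![1, 0, 0, 0] D| = 0 := by
        by_contra hz; exact p1 (s1.1 (by have := abs_nonneg (Psi hgt ![1, 0, 0, 0] D); omega))
      have p2 : 16 ≤ |Psi hgt ![2, 0, 0, 0] D| := by omega
      have p3 : 16 ≤ |Psi hgt ![3, 0, 0, 0] D| := by omega
      exact ⟨2, 3, by decide, p2, p3⟩

/-! ## §4 A class with `Ψ > 0` is an N-cover of multiplicity `Ψ ∕ 16`; `Ψ < 0` a P-cover -/

/-- N-COVER: on a box with `Ψ_x > 0`, N out-weighs P by `Ψ_x ≥ 16`. -/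
theorem Ncover_of_Psi_pos (hgt : ℤ) (D : Design) (hO : D.OnAlphabet hgt) (x : Fin 4 → Fin 4) (h : 0 < Psi hgt x D) :
    16 ≤ Psi hgt x D ∧ Psi hgt x D + linZ D.P (psi hgt x) = linZ D.N (psi hgt x) := by
  have hd := Psi_dvd_sixteen hgt D hO x
  refine ⟨by omega, ?_⟩
  unfold Psi
  omega

/-- … and the box MEETS the N support (some N cell with all four slabs positive). -/
theorem Nmeets_of_Psi_pos (hgt : ℤ) (D : Design) (hO : D.OnAlphabet hgt) (x : Fin 4 → Fin 4) (h : 0 < Psi hgt x D) :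
    ∃ c ∈ D.suppN, 0 < psi hgt x c := by
  have hP := linZP_psi_nonneg hgt D hO x
  have hN : 0 < linZ D.N (psi hgt x) := by unfold Psi at h; omega
  obtain ⟨cm, hcm, hm, hc⟩ := exists_alive_of_linZ_pos D.N (psi hgt x) hN
  exact ⟨cm.1, (mem_suppN_iff D cm.1).2 ⟨cm.2, by simpa using hcm, hm⟩, hc⟩

/-- P-COVER: on a box with `Ψ_x < 0`, P out-weighs N by `−Ψ_x ≥ 16`. -/
theorem Pcover_of_Psi_neg (hgt : ℤ) (D : Design) (hO : D.OnAlphabet hgt) (x : Fin 4 → Fin 4) (h : Psi hgt x D < 0) :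
    Psi hgt x D ≤ -16 ∧ -Psi hgt x D + linZ D.N (psi hgt x) = linZ D.P (psi hgt x) := by
  have hd := Psi_dvd_sixteen hgt D hO x
  refine ⟨by omega, ?_⟩
  unfold Psi
  omega

/-- … and the box MEETS the P support. -/
theorem Pmeets_of_Psi_neg (hgt : ℤ) (D : Design) (hO : D.OnAlphabet hgt) (x : Fin 4 → Fin 4) (h : Psi hgt x D < 0) :
    ∃ c ∈ D.suppP, 0 < psi hgt x c := by
  have hN := linZN_psi_nonneg hgt D hO x
  have hP : 0 < linZ D.P (psi hgt x) := by unfold Psi at h; omega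
  obtain ⟨cm, hcm, hm, hc⟩ := exists_alive_of_linZ_pos D.P (psi hgt x) hP
  exact ⟨cm.1, (mem_suppP_iff D cm.1).2 ⟨cm.2, by simpa using hcm, hm⟩, hc⟩

/-! ## §5 σ versus the charge: the LP hulls (K1)–(K2) of `SHELL3-LPCUTS` in kernel form -/

/-- `σ = 0` forces the 32-lattice: `32 ∣ Re μ ∧ 32 ∣ Im μ`. -/
theorem sigma_zero_lattice (hgt : ℤ) (D : Design) (hO : D.OnAlphabet hgt) (hA : A1e D) (hσ : Sigma hgt D = 0) :
    32 ∣ D.mu.re ∧ 32 ∣ D.mu.im := by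
  obtain ⟨-, -, l2, l3⟩ := lattice_sixteen hgt D hO hA
  rw [hσ] at l3
  constructor <;> omega

/-- The minimal charge `|Re μ| = 16` (or `|Im μ| = 16`) forces `σ ≡ 8 (mod 16)`, in particular `|σ| ≥ 8`. -/
theorem abs_sigma_ge_8_of_re_16 (hgt : ℤ) (D : Design) (hO : D.OnAlphabet hgt) (hA : A1e D) (h : |D.mu.re| = 16) :
    8 ≤ |Sigma hgt D| := by
  obtain ⟨-, -, -, l3⟩ := lattice_sixteen hgt D hO hA
  rcases le_or_gt 0 D.mu.re with hr | hr <;> rcases le_or_gt 0 (Sigma hgt D) with hs | hs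
  · rw [abs_of_nonneg hr] at h; rw [abs_of_nonneg hs]; omega
  · rw [abs_of_nonneg hr] at h; rw [abs_of_neg hs]; omega
  · rw [abs_of_neg hr] at h; rw [abs_of_nonneg hs]; omega
  · rw [abs_of_neg hr] at h; rw [abs_of_neg hs]; omega

theorem abs_sigma_ge_8_of_im_16 (hgt : ℤ) (D : Design) (hO : D.OnAlphabet hgt) (hA : A1e D) (h : |D.mu.im| = 16) :
    8 ≤ |Sigma hgt D| := by
  obtain ⟨-, -, l2, l3⟩ := lattice_sixteen hgt D hO hA
  rcases le_or_gt 0 D.mu.im with hi | hi <;> rcases le_or_gt 0 (Sigma hgt D) with hs | hs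
  · rw [abs_of_nonneg hi] at h; rw [abs_of_nonneg hs]; omega
  · rw [abs_of_nonneg hi] at h; rw [abs_of_neg hs]; omega
  · rw [abs_of_neg hi] at h; rw [abs_of_nonneg hs]; omega
  · rw [abs_of_neg hi] at h; rw [abs_of_neg hs]; omega

/-- **CHARGE–σ HULL.** `μ ≠ 0 → max(|Re μ|, |Im μ|) + 2|σ| ≥ 32`: either the charge is on the 32-level in sup-norm, or it is the
minimal charge and then `|σ| ≥ 8` — the symmetric form of the LP cut (K2). -/
theorem charge_sigma_hull (hgt : ℤ) (D : Design) (hO : D.OnAlphabet hgt) (hA : A1e D) (hμ : D.mu ≠ 0) :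
    32 ≤ max |D.mu.re| |D.mu.im| + 2 * |Sigma hgt D| := by
  obtain ⟨l0, l1, l2, l3⟩ := lattice_sixteen hgt D hO hA
  have hs0 : 0 ≤ |Sigma hgt D| := abs_nonneg _
  have hmr : |D.mu.re| ≤ max |D.mu.re| |D.mu.im| := le_max_left _ _
  have hmi : |D.mu.im| ≤ max |D.mu.re| |D.mu.im| := le_max_right _ _
  rcases sup_ge_16 hgt D hO hA hμ with h | h
  · by_cases h32 : 32 ≤ |D.mu.re|
    · omega
    · have h16 : |D.mu.re| = 16 := by
        rcases le_or_gt 0 D.mu.re with hr | hr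
        · rw [abs_of_nonneg hr] at h h32 ⊢; omega
        · rw [abs_of_neg hr] at h h32 ⊢; omega
      have := abs_sigma_ge_8_of_re_16 hgt D hO hA h16
      omega
  · by_cases h32 : 32 ≤ |D.mu.im|
    · omega
    · have h16 : |D.mu.im| = 16 := by
        rcases le_or_gt 0 D.mu.im with hi | hi
        · rw [abs_of_nonneg hi] at h h32 ⊢; omega
        · rw [abs_of_neg hi] at h h32 ⊢; omega
      have := abs_sigma_ge_8_of_im_16 hgt D hO hA h16
      omega

end Summit.HodgeConjecture.HodgeConjecture.Cruxes.BlochSeedDiscOne.CoverDemand
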